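import Literature.NumberTheory.EllipticCurves.HeegnerNormPointExistenceProofs
import Literature.NumberTheory.EllipticCurves.Darmon2004.HeegnerNormCompatibilityInertProofs
import Literature.FieldTheory.AlgClosed.AutFixedSubfield
import Literature.NumberTheory.EllipticCurves.RingClassFieldGenerator
import HarnessLib

/-!
# Galois transfer along `jbar : K̄ → ℂ`: from the `Γ_K`-module `E(K̄)` (`geomPoints`, `ringClassSubgroup`,
# `complexPoint`, the vocabulary of `HeegnerModuleIndex`) to the concrete ring class fields `K[c] ⊂ ℂ`
# (`ringClassField`, `ringClassGal(Over)`, `pointGalHom`, the vocabulary of the Heegner trace relations)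

Topic `NumberTheory/EllipticCurves` (complex multiplication / Heegner points). THEOREMS ONLY (no
definition, no named fact; net Literature debt `0`). Cell `bsd-print-x9` (D-0154 row 9), seat x9-p1
(LEAD of the line on crux `PrintX9.HowardContainmentLightFrameOfPrint`, stmt-BirchSwinnertonDyer-25235, and of
its PIN-1 twin): infrastructure for the registered envelope stubs `stub_envelope` / `stub_envelopeTied`
(Howard 2004 §3.3 / Perrin-Riou 1987 §3 / CGLS 2022 Rem. 4.1.4: the Heegner module `ℋ_∞` of a norm-point
family versus the `α`-stabilised class module `Λκ_∞`), whose proof needs the VERTICAL DISTRIBUTION RELATIONS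
`Tr_{K[p^{d+1}]/K[p^d]} P[p^{d+1}] = a_p P[p^d] − P[p^{d-1}]`. Those relations are PROVED in the tree for
Gross's principal Heegner points read in `E(K[c]) ⊂ E(ℂ)` with Galois groups `Gal(K[c']/K[c])` of the
concrete subfields `K[c] = ringClassField K ι c ⊂ ℂ` (`HeegnerTraceRelationDividingProofs`,
`Darmon2004.prop310_dvd`), whereas the Heegner modules are built from norm points
`∑_{r ∈ R} r • x ∈ E(K̄)` over transversals `R` of `ringClassSubgroup K c' jbar` (`IsHeegnerNormPoint`,
`HeegnerModuleIndex`). This file is the dictionary between the two (nothing Heegner-specific is used):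

* §1 `exists_ringEquiv_apply_eq_smul` — every `σ ∈ Γ_K` is induced along `jbar` by an automorphism `σ̃`
  of `ℂ` (`jbar(K̄)` is countable; `Complex.exists_ringEquiv_apply_eq_of_subfield`);
* §2 `exists_ringEquiv_exists_mem_ringClassGal_of_absoluteGaloisGroup` — hence `σ` restricts to an element
  of `𝒢_c = ringClassGal ι c` (`Aut(ℂ/ι K)` stabilises `K[c]`, Cox Thm. 11.1); `Gal(K̄/K[c]) =
  ringClassSubgroup K c jbar` is EXACTLY the kernel (`ringEquiv_apply_eq_self_of_mem_ringClassSubgroup`,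
  `mem_ringClassSubgroup_of_ringEquiv_apply_eq_self`);
* §3 `complexPoint_smul_eq_map` — `(σ • x)_ℂ = σ̃ ⋆ x_ℂ`, and `complexPoint` is injective;
* §4 `exists_absoluteGaloisGroup_of_ringEquiv`, `exists_mem_ringClassSubgroup_induces_of_mem_ringClassGalOver`
  — conversely every automorphism of `ℂ` over `ι(K)`, in particular every `g ∈ Gal(K[c']/K[c])`, is induced
  by some `τ ∈ Γ_K` (resp. `τ ∈ Gal(K̄/K[c])`): `σ̃` permutes `jbar(K̄) = ℚ̄ ⊂ ℂ` and `K̄/K` is algebraic;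
* §5 `exists_finset_ringClassGalOver_complexPoint_sum_smul_eq` — for `c ∣ c'` and a transversal `R` of
  `Gal(K̄/K[c'])` in `Gal(K̄/K[c])`, the restrictions of `R` ARE `Gal(K[c']/K[c])` and
  `(∑_{r ∈ R} r • x)_ℂ = (∑_{g ∈ Gal(K[c']/K[c])} g • P)_ℂ` whenever `x_ℂ = P_ℂ` with `P ∈ E(K[c'])`:
  Howard's / Perrin-Riou's norms are Gross's / Darmon's traces.

HONEST FRAMING: classical Galois theory only; nothing on `L`-functions, Selmer groups or BSD is asserted.
References: [GrossLMS1991] §3; [PerrinRiou1987BSMF] §3.2–3.4; [Cox2013] Thm. 11.1; [SilvermanAEC2009] VIII.§1; [Lang2002] V §2, VIII §1.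

-/

set_option autoImplicit false

noncomputable section

open scoped Classical Cardinal

namespace Literature.NumberTheory.EllipticCurves

open WeierstrassCurve RingClassField

variable {K : Type} [Field K] [NumberField K]

/-! ## §1 Every `σ ∈ Γ_K` is induced by an automorphism of `ℂ` along `jbar` -/

/-- `K̄` is algebraic over `ℚ` (it is algebraic over the number field `K`). [folklore] -/
private theorem isAlgebraic_rat_algebraicClosure : Algebra.IsAlgebraic ℚ (AlgebraicClosure K) :=
  Algebra.IsAlgebraic.trans ℚ K (AlgebraicClosure K)

/-- The image `jbar(K̄) ⊆ ℂ` is countable (algebraic over `ℚ`). [folklore] -/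
private theorem cardinalMk_fieldRange_le_aleph0 (jbar : AlgebraicClosure K →+* ℂ) :
    #jbar.fieldRange ≤ ℵ₀ := by
  haveI : Algebra.IsAlgebraic ℚ jbar.fieldRange := by
    refine ⟨fun x ↦ ?_⟩
    obtain ⟨a, ha⟩ := jbar.mem_fieldRange.mp x.2
    haveI := isAlgebraic_rat_algebraicClosure (K := K)
    have h1 : IsAlgebraic ℚ (jbar a) :=
      (Algebra.IsAlgebraic.isAlgebraic (R := ℚ) a).algHom jbar.toRatAlgHom
    rw [ha] at h1
    exact (isAlgebraic_algebraMap_iff (R := ℚ) (A := ℂ) (S := jbar.fieldRange)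
      (jbar.fieldRange.subtype.injective)).mp h1
  exact Literature.FieldTheory.AlgClosed.Subfield.cardinalMk_le_aleph0_of_isAlgebraic _

/-- **Every `σ ∈ Γ_K = Gal(K̄/K)` is the restriction along `jbar : K̄ → ℂ` of an automorphism of `ℂ`:**
there is `σ̃ ∈ Aut(ℂ)` with `σ̃ (jbar a) = jbar (σ • a)` for all `a ∈ K̄` (extension of the embedding
`jbar ∘ σ ∘ jbar⁻¹` of the countable subfield `jbar(K̄)`; Lang, *Algebra*, VIII §1).
[cite: Lang2002, Ch. VIII §1 (extension of automorphisms to an algebraically closed overfield)] -/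
theorem exists_ringEquiv_apply_eq_smul (jbar : AlgebraicClosure K →+* ℂ)
    (σ : Field.absoluteGaloisGroup K) :
    ∃ σC : ℂ ≃+* ℂ, ∀ a : AlgebraicClosure K, σC (jbar a) = jbar (σ • a) := by
  -- `jbar` as an isomorphism onto its range
  let e : AlgebraicClosure K ≃+* jbar.fieldRange := jbar.rangeRestrictFieldEquiv
  have he : ∀ a, ((e a : jbar.fieldRange) : ℂ) = jbar a := fun a ↦ rfl
  -- the embedding `jbar ∘ σ ∘ jbar⁻¹ : jbar(K̄) → ℂ`
  let φ : jbar.fieldRange →+* ℂ :=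
    jbar.comp (((Field.absoluteGaloisGroup.toAlgEquiv K σ).toRingEquiv.toRingHom).comp
      e.symm.toRingHom)
  obtain ⟨σC, hσC⟩ := Literature.FieldTheory.AlgClosed.Complex.exists_ringEquiv_apply_eq_of_subfield
    jbar.fieldRange (cardinalMk_fieldRange_le_aleph0 jbar) φ
  refine ⟨σC, fun a ↦ ?_⟩
  have h := hσC (e a)
  rw [he] at h
  rw [h]
  show jbar ((Field.absoluteGaloisGroup.toAlgEquiv K σ) (e.symm (e a))) = jbar (σ • a)
  rw [e.symm_apply_apply, Field.absoluteGaloisGroup.smul_def]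

/-! ## §2 The restriction of `σ ∈ Γ_K` to the concrete ring class field `K[c] ⊂ ℂ` -/

omit [NumberField K] in
/-- An automorphism of `ℂ` inducing `σ ∈ Γ_K` along `jbar` fixes `ι(K)`, `ι = jbar ∘ (K → K̄)`. [folklore] -/
private theorem ringEquiv_apply_comp_algebraMap_eq {jbar : AlgebraicClosure K →+* ℂ} {σ : Field.absoluteGaloisGroup K}
    {σC : ℂ ≃+* ℂ} (hσC : ∀ a : AlgebraicClosure K, σC (jbar a) = jbar (σ • a)) (k : K) :
    σC ((jbar.comp (algebraMap K (AlgebraicClosure K))) k) =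
      (jbar.comp (algebraMap K (AlgebraicClosure K))) k := by
  rw [RingHom.comp_apply, hσC, Field.absoluteGaloisGroup.smul_def, AlgEquiv.commutes]

/-- **`σ ∈ Γ_K` restricts to an element of `𝒢_c = Gal(K[c]/K)`** along `jbar`: there are
`σ̃ ∈ Aut(ℂ)` inducing `σ` (`σ̃ ∘ jbar = jbar ∘ σ`) and `g ∈ ringClassGal ι c` with `g = σ̃` on
`K[c] = ringClassField K ι c` (`Aut(ℂ/ι(K))` stabilises `K[c]`, Cox Thm. 11.1 / Darmon Thm. 3.5:
`Darmon2004.exists_mem_ringClassGal_coe_eq`). [cite: Cox2013, Thm. 11.1] [cite: Darmon2004, Thm. 3.5] -/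
theorem exists_ringEquiv_exists_mem_ringClassGal_of_absoluteGaloisGroup (hK : IsImaginaryQuadratic K)
    (jbar : AlgebraicClosure K →+* ℂ) {c : ℕ} (hc : c ≠ 0) (σ : Field.absoluteGaloisGroup K) :
    ∃ σC : ℂ ≃+* ℂ, (∀ a : AlgebraicClosure K, σC (jbar a) = jbar (σ • a)) ∧
      ∃ g ∈ ringClassGal (jbar.comp (algebraMap K (AlgebraicClosure K))) c,
        ∀ x : ringClassField K (jbar.comp (algebraMap K (AlgebraicClosure K))) c,
          ((g x : ringClassField K (jbar.comp (algebraMap K (AlgebraicClosure K))) c) : ℂ) = σC x := by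
  obtain ⟨σC, hσC⟩ := exists_ringEquiv_apply_eq_smul jbar σ
  set ι : K →+* ℂ := jbar.comp (algebraMap K (AlgebraicClosure K)) with hι
  have hσK : ∀ k : K, σC (ι k) = ι k := fun k ↦ ringEquiv_apply_comp_algebraMap_eq hσC k
  obtain ⟨g, hg, hgx⟩ := Darmon2004.exists_mem_ringClassGal_coe_eq hK ι hc hσK
  exact ⟨σC, hσC, g, hg, hgx⟩

/-- **`Gal(K̄/K[c])` acts trivially on `K[c]`**: if `σ ∈ ringClassSubgroup K c jbar` then any `σ̃ ∈ Aut(ℂ)`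
inducing `σ` along `jbar` fixes `K[c] = ringClassField K ι c` pointwise (`K[c] ⊆ jbar(K̄)` and `σ`
fixes the `jbar`-preimages, `smul_eq_self_of_mem_ringClassSubgroup`). [cite: Cox2013, Thm. 11.1] -/
theorem ringEquiv_apply_eq_self_of_mem_ringClassSubgroup (hK : IsImaginaryQuadratic K)
    {jbar : AlgebraicClosure K →+* ℂ} {c : ℕ} (hc : c ≠ 0) {σ : Field.absoluteGaloisGroup K}
    (hσ : σ ∈ ringClassSubgroup K c jbar) {σC : ℂ ≃+* ℂ}
    (hσC : ∀ a : AlgebraicClosure K, σC (jbar a) = jbar (σ • a)) {x : ℂ}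
    (hx : x ∈ ringClassField K (jbar.comp (algebraMap K (AlgebraicClosure K))) c) : σC x = x := by
  obtain ⟨a, rfl⟩ := mem_range_of_mem_ringClassField hK jbar hc hx
  rw [hσC, smul_eq_self_of_mem_ringClassSubgroup hK jbar hc hσ hx]

/-- **Conversely, `σ ∈ Γ_K` lies in `Gal(K̄/K[c]) = ringClassSubgroup K c jbar` as soon as an automorphism
of `ℂ` inducing it fixes `K[c]` pointwise**: the singular moduli of discriminant `c²d_K` lie in `K[c]`
(`ringClassSingularModuli_subset_ringClassField`), so `σ` fixes their `jbar`-preimages, which is the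
definition of `ringClassSubgroup`. [cite: Cox2013, Thm. 11.1] -/
theorem mem_ringClassSubgroup_of_ringEquiv_apply_eq_self {jbar : AlgebraicClosure K →+* ℂ} {c : ℕ}
    {σ : Field.absoluteGaloisGroup K} {σC : ℂ ≃+* ℂ}
    (hσC : ∀ a : AlgebraicClosure K, σC (jbar a) = jbar (σ • a))
    (hfix : ∀ x ∈ ringClassField K (jbar.comp (algebraMap K (AlgebraicClosure K))) c, σC x = x) :
    σ ∈ ringClassSubgroup K c jbar := by
  simp only [ringClassSubgroup, Subgroup.mem_comap, Subgroup.mem_iInf, MulAction.mem_stabilizer_iff]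
  intro a ha
  have haK : jbar a ∈ ringClassField K (jbar.comp (algebraMap K (AlgebraicClosure K))) c := by
    refine ringClassSingularModuli_subset_ringClassField _ c ?_
    simp only [ringClassSingularModuli, Finset.mem_coe]
    rwa [mul_comm] at ha
  have h := hfix _ haK
  rw [hσC] at h
  have h' : σ • a = a := jbar.injective h
  rwa [Field.absoluteGaloisGroup.smul_def] at h'

/-! ## §3 `complexPoint` is injective and `Γ_K`-equivariant along `jbar` -/

section ComplexPoint

variable (W : WeierstrassCurve ℚ)

/-- `complexPoint W jbar : E(K̄) → E(ℂ)` is injective (`jbar` is; a point is its pair of coordinates).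
[cite: SilvermanAEC2009, VIII.§1 (E(K̄) and its coordinates under field embeddings)] -/
theorem complexPoint_injective (jbar : AlgebraicClosure K →+* ℂ) :
    Function.Injective (complexPoint W jbar) := by
  intro x y h
  simp only [complexPoint, AddMonoidHom.coe_comp, Function.comp_apply] at h
  exact (WeierstrassCurve.Affine.Point.congrEquiv _).injective
    (WeierstrassCurve.Affine.Point.map_injective (f := jbar.toRatAlgHom) h)

omit [NumberField K] in
/-- Nonsingularity is preserved by `σ ∈ Γ_K` (coordinates moved by a `K`-automorphism of `K̄`). [folklore] -/
private theorem nonsingular_smul (V : WeierstrassCurve K) (σ : Field.absoluteGaloisGroup K)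
    {a b : AlgebraicClosure K} (h : (V.baseChange (AlgebraicClosure K)).toAffine.Nonsingular a b) :
    (V.baseChange (AlgebraicClosure K)).toAffine.Nonsingular (σ • a) (σ • b) :=
  (WeierstrassCurve.Affine.baseChange_nonsingular (W := V) (f := GeomTransport.galHom σ)
    (GeomTransport.galHom σ).toRingHom.injective a b).mpr h

/-- `complexPoint` on an affine point: `(a, b) ↦ (jbar a, jbar b)`. [folklore] -/
private theorem complexPoint_some (jbar : AlgebraicClosure K →+* ℂ) {a b : AlgebraicClosure K}
    (h : ((W.baseChange K).baseChange (AlgebraicClosure K)).toAffine.Nonsingular a b)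
    (h' : (W.baseChange ℂ).toAffine.Nonsingular (jbar a) (jbar b)) :
    complexPoint W jbar (.some a b h) = .some (jbar a) (jbar b) h' := by
  have hbc : (W.baseChange K).map (Algebra.ofId K (AlgebraicClosure K) : K →+* AlgebraicClosure K) =
      W.baseChange (AlgebraicClosure K) := W.map_baseChange (Algebra.ofId K (AlgebraicClosure K))
  show WeierstrassCurve.Affine.Point.map jbar.toRatAlgHom
      (WeierstrassCurve.Affine.Point.congrEquiv hbc (.some a b h)) = _
  rw [WeierstrassCurve.Affine.Point.congrEquiv_some]
  rfl

/-- The complex coordinates of a geometric point are nonsingular (transport along `jbar`). [folklore] -/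
private theorem nonsingular_jbar (jbar : AlgebraicClosure K →+* ℂ) {a b : AlgebraicClosure K}
    (h : ((W.baseChange K).baseChange (AlgebraicClosure K)).toAffine.Nonsingular a b) :
    (W.baseChange ℂ).toAffine.Nonsingular (jbar a) (jbar b) := by
  have hbc : (W.baseChange K).map (Algebra.ofId K (AlgebraicClosure K) : K →+* AlgebraicClosure K) =
      W.baseChange (AlgebraicClosure K) := W.map_baseChange (Algebra.ofId K (AlgebraicClosure K))
  have h1 : (W.baseChange (AlgebraicClosure K)).toAffine.Nonsingular a b := by
    rw [← hbc]; exact h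
  exact (WeierstrassCurve.Affine.baseChange_nonsingular (W := W) (f := jbar.toRatAlgHom) jbar.injective
    a b).mpr h1

/-- **`Γ_K`-equivariance of `complexPoint` along `jbar`**: `(σ • x)_ℂ = σ̃ ⋆ x_ℂ` for any automorphism
`σ̃` of `ℂ` inducing `σ` (coordinates: `jbar (σ a) = σ̃ (jbar a)`). [cite: SilvermanAEC2009, VIII.§1 (the Galois action on coordinates)] -/
theorem complexPoint_smul_eq_map (jbar : AlgebraicClosure K →+* ℂ) {σ : Field.absoluteGaloisGroup K}
    {σC : ℂ ≃+* ℂ} (hσC : ∀ a : AlgebraicClosure K, σC (jbar a) = jbar (σ • a))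
    (x : WeierstrassCurve.geomPoints (W.baseChange K)) :
    complexPoint W jbar (σ • x) =
      WeierstrassCurve.Affine.Point.map (W' := W) (σC : ℂ →+* ℂ).toRatAlgHom (complexPoint W jbar x) := by
  rcases x with _ | ⟨a, b, hab⟩
  · show complexPoint W jbar (σ • (0 : WeierstrassCurve.geomPoints (W.baseChange K))) =
      WeierstrassCurve.Affine.Point.map (W' := W) (σC : ℂ →+* ℂ).toRatAlgHom (complexPoint W jbar 0)
    rw [smul_zero, map_zero, map_zero]
  · rw [GeomTransport.smul_eq_map_galHom]
    have hm : WeierstrassCurve.Affine.Point.map (GeomTransport.galHom σ)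
        (WeierstrassCurve.Affine.Point.some a b hab) =
        WeierstrassCurve.Affine.Point.some (σ • a) (σ • b) (nonsingular_smul (W.baseChange K) σ hab) :=
      rfl
    rw [hm, complexPoint_some W jbar _ (nonsingular_jbar W jbar (nonsingular_smul (W.baseChange K) σ hab)),
      complexPoint_some W jbar hab (nonsingular_jbar W jbar hab), WeierstrassCurve.Affine.Point.map_some]
    simp only [WeierstrassCurve.Affine.Point.some.injEq]
    exact ⟨(hσC a).symm, (hσC b).symm⟩

end ComplexPoint

/-! ## §4 Lifting: automorphisms of `ℂ` over `ι(K)` and elements of `𝒢_c` come from `Γ_K` -/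

/-- **Every automorphism of `ℂ` fixing `ι(K)` is induced along `jbar` by some `τ ∈ Γ_K`**: `σ` permutes
the algebraic numbers, `jbar(K̄)` is the algebraic closure of `ℚ` in `ℂ` (`mem_range_of_isAlgebraic`), so
`jbar⁻¹ ∘ σ ∘ jbar` is a `K`-endomorphism of `K̄`, bijective since `K̄/K` is algebraic
(`Algebra.IsAlgebraic.algHom_bijective`).
[cite: Lang2002, Ch. V §2 Thm. 2.8 (embeddings of algebraic extensions; σ(ℚ̄) = ℚ̄)] -/
theorem exists_absoluteGaloisGroup_of_ringEquiv (jbar : AlgebraicClosure K →+* ℂ) (σ : ℂ ≃+* ℂ)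
    (hσK : ∀ k : K, σ ((jbar.comp (algebraMap K (AlgebraicClosure K))) k) =
      (jbar.comp (algebraMap K (AlgebraicClosure K))) k) :
    ∃ τ : Field.absoluteGaloisGroup K, ∀ a : AlgebraicClosure K, σ (jbar a) = jbar (τ • a) := by
  haveI := isAlgebraic_rat_algebraicClosure (K := K)
  -- `σ (jbar a)` is algebraic, hence a value of `jbar`
  have hmem : ∀ a : AlgebraicClosure K, σ (jbar a) ∈ Set.range jbar := fun a ↦ by
    have h1 : IsAlgebraic ℚ (jbar a) :=
      (Algebra.IsAlgebraic.isAlgebraic (R := ℚ) a).algHom jbar.toRatAlgHom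
    have h2 : IsAlgebraic ℚ (σ (jbar a)) := h1.algHom (σ : ℂ →+* ℂ).toRatAlgHom
    exact mem_range_of_isAlgebraic jbar.toRatAlgHom h2
  choose f hf using hmem
  -- `f` is a `K`-algebra endomorphism of `K̄`
  have hf1 : f 1 = 1 := jbar.injective (by rw [hf, map_one, map_one])
  have hfmul : ∀ a b, f (a * b) = f a * f b := fun a b ↦
    jbar.injective (by rw [hf, map_mul, map_mul, map_mul, hf, hf])
  have hf0 : f 0 = 0 := jbar.injective (by rw [hf, map_zero, map_zero])
  have hfadd : ∀ a b, f (a + b) = f a + f b := fun a b ↦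
    jbar.injective (by rw [hf, map_add, map_add, map_add, hf, hf])
  let fr : AlgebraicClosure K →+* AlgebraicClosure K :=
    { toFun := f, map_one' := hf1, map_mul' := hfmul, map_zero' := hf0, map_add' := hfadd }
  have hfK : ∀ k : K, f (algebraMap K (AlgebraicClosure K) k) = algebraMap K (AlgebraicClosure K) k :=
    fun k ↦ jbar.injective (by rw [hf]; exact hσK k)
  let fa : AlgebraicClosure K →ₐ[K] AlgebraicClosure K := { fr with commutes' := hfK }
  let τ : AlgebraicClosure K ≃ₐ[K] AlgebraicClosure K :=
    AlgEquiv.ofBijective fa (Algebra.IsAlgebraic.algHom_bijective fa)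
  refine ⟨(Field.absoluteGaloisGroup.toAlgEquiv K).symm τ, fun a ↦ ?_⟩
  rw [Field.absoluteGaloisGroup.toAlgEquiv_symm_apply]
  exact (hf a).symm

/-- **Every `g ∈ Gal(K[c']/K[c])` extends to an automorphism of `ℂ` over `K[c]`** (`c ∣ c'`, `c' ≠ 0`;
copy of the private helper of `HeegnerTraceRelationDividingProofs`, via `exists_ringEquiv_apply_eq_algEquiv`).
[cite: GrossLMS1991, §3 (proof of Prop. 3.7: conjugates of x_n over K_m)] -/
theorem exists_ringEquiv_extends_of_mem_ringClassGalOver' (hK : IsImaginaryQuadratic K)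
    (ι : K →+* ℂ) {m n : ℕ} (hmn : m ∣ n) (hn : n ≠ 0)
    {g : ringClassField K ι n ≃ₐ[ℚ] ringClassField K ι n} (hg : g ∈ ringClassGalOver ι n m) :
    ∃ σ : ℂ ≃+* ℂ, (∀ x ∈ ringClassField K ι m, σ x = x) ∧
      ∀ x : ringClassField K ι n, σ x = ((g x : ringClassField K ι n) : ℂ) := by
  letI : Algebra K ℂ := ι.toAlgebra
  have hg' : ∀ y ∈ {x : ringClassField K ι n | (x : ℂ) ∈ ringClassField K ι m}, g • y = y :=
    (_root_.mem_fixingSubgroup_iff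
      (M := ringClassField K ι n ≃ₐ[ℚ] ringClassField K ι n)).mp hg
  let g' : ringClassField K ι n ≃ₐ[subfieldIn ι n m] ringClassField K ι n :=
    { (g : ringClassField K ι n ≃+* ringClassField K ι n) with
      commutes' := fun r => hg' r.1 ((mem_subfieldIn_iff ι n m r.1).mp r.2) }
  obtain ⟨σ, hσm, hσn⟩ := exists_ringEquiv_apply_eq_algEquiv hK ι hmn hn g'
  exact ⟨σ, hσm, fun x => hσn x⟩

/-- **Lifting `Gal(K[c']/K[c])` to `Gal(K̄/K[c])`**: for `c ∣ c'`, `c, c' ≠ 0` and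
`g ∈ ringClassGalOver ι c' c` there are `τ ∈ ringClassSubgroup K c jbar` and an automorphism `τ̃` of `ℂ`
inducing `τ` along `jbar` whose restriction to `K[c']` is `g`. [cite: GrossLMS1991, §3 (proof of Prop. 3.7)] -/
theorem exists_mem_ringClassSubgroup_induces_of_mem_ringClassGalOver (hK : IsImaginaryQuadratic K)
    (jbar : AlgebraicClosure K →+* ℂ) {c c' : ℕ} (hcc' : c ∣ c') (hc' : c' ≠ 0)
    {g : ringClassField K (jbar.comp (algebraMap K (AlgebraicClosure K))) c' ≃ₐ[ℚ]
      ringClassField K (jbar.comp (algebraMap K (AlgebraicClosure K))) c'}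
    (hg : g ∈ ringClassGalOver (jbar.comp (algebraMap K (AlgebraicClosure K))) c' c) :
    ∃ τ ∈ ringClassSubgroup K c jbar, ∃ τC : ℂ ≃+* ℂ,
      (∀ a : AlgebraicClosure K, τC (jbar a) = jbar (τ • a)) ∧
      ∀ x : ringClassField K (jbar.comp (algebraMap K (AlgebraicClosure K))) c',
        τC x = ((g x : ringClassField K (jbar.comp (algebraMap K (AlgebraicClosure K))) c') : ℂ) := by
  set ι : K →+* ℂ := jbar.comp (algebraMap K (AlgebraicClosure K)) with hι
  obtain ⟨σ, hσm, hσn⟩ := exists_ringEquiv_extends_of_mem_ringClassGalOver' hK ι hcc' hc' hg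
  have hσK : ∀ k : K, σ (ι k) = ι k := fun k ↦ hσm _ (apply_mem_ringClassField ι c k)
  obtain ⟨τ, hτ⟩ := exists_absoluteGaloisGroup_of_ringEquiv jbar σ hσK
  exact ⟨τ, mem_ringClassSubgroup_of_ringEquiv_apply_eq_self hτ hσm, σ, hτ, hσn⟩

/-! ## §5 Transversal sums in `E(K̄)` are Galois traces in `E(K[c'])` -/

section Transversal

variable (W : WeierstrassCurve ℚ)

/-- `(σ′ • Z)_ℂ = σ(Z_ℂ)` for the restriction `σ′ ∈ Aut(K[m])` of `σ ∈ Aut(ℂ)` (copy of the private helper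
of `HeegnerNormCompatibilityInertProofs`). [folklore] -/
private theorem map_subtype_pointGalHom_eq_map (ι : K →+* ℂ) {m : ℕ} {σ : ℂ ≃+* ℂ}
    {σ' : ringClassField K ι m ≃ₐ[ℚ] ringClassField K ι m}
    (hσ' : ∀ x : ringClassField K ι m, ((σ' x : ringClassField K ι m) : ℂ) = σ x)
    (Z : (W.baseChange (ringClassField K ι m)).toAffine.Point) :
    WeierstrassCurve.Affine.Point.map (W' := W) (ringClassField K ι m).subtype.toRatAlgHom
        (pointGalHom W (ringClassField K ι m) σ' Z) =
      WeierstrassCurve.Affine.Point.map (W' := W) (σ : ℂ →+* ℂ).toRatAlgHom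
        (WeierstrassCurve.Affine.Point.map (W' := W) (ringClassField K ι m).subtype.toRatAlgHom Z) := by
  rw [pointGalHom_apply, WeierstrassCurve.Affine.Point.map_map, WeierstrassCurve.Affine.Point.map_map]
  exact WeierstrassCurve.Affine.Point.map_congr_fun (fun x ↦ hσ' x) _

/-- **Transversal sums in `E(K̄)` ARE Galois traces in `E(K[c'])`.** For `c ∣ c'` (both `≠ 0`), a point
`x ∈ E(K̄)` realised over `K[c'] ⊂ ℂ` by `P ∈ E(K[c'])` (`x_ℂ = P_ℂ`), and a finite transversal `R` of
`Gal(K̄/K[c'])` in `Gal(K̄/K[c])` (the tree's `IsHeegnerNormPoint` shape: `R ⊆ ringClassSubgroup K c jbar`,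
every `τ` in it has a unique `r ∈ R` with `r⁻¹τ ∈ ringClassSubgroup K c' jbar`), the restrictions of the
`r ∈ R` to `K[c']` form exactly `Gal(K[c']/K[c]) = ringClassGalOver ι c' c`, and
`(∑_{r ∈ R} r • x)_ℂ = (∑_{g ∈ Gal(K[c']/K[c])} g • P)_ℂ`. This is the dictionary between Howard's /
Perrin-Riou's norms `Norm_{K[c']/K[c]}` read in `E(K̄)` (`HeegnerModuleIndex`) and Gross's / Darmon's traces
read in `E(K[c']) ⊂ E(ℂ)` (`HeegnerTraceRelation*Proofs`). [cite: GrossLMS1991, §3 (Tr_{K_n/K_m}, proof of Prop. 3.7)]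
[cite: PerrinRiou1987BSMF, §3.2–3.4 (traces to the layers)] -/
theorem exists_finset_ringClassGalOver_complexPoint_sum_smul_eq (hK : IsImaginaryQuadratic K)
    (jbar : AlgebraicClosure K →+* ℂ) {c c' : ℕ} (hc : c ≠ 0) (hc' : c' ≠ 0) (hcc' : c ∣ c')
    {x : WeierstrassCurve.geomPoints (W.baseChange K)}
    {P : (W.baseChange (ringClassField K (jbar.comp (algebraMap K (AlgebraicClosure K))) c')).toAffine.Point}
    (hxP : complexPoint W jbar x = WeierstrassCurve.Affine.Point.map (W' := W)
      (ringClassField K (jbar.comp (algebraMap K (AlgebraicClosure K))) c').subtype.toRatAlgHom P)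
    {R : Finset (Field.absoluteGaloisGroup K)} (hRsub : ∀ r ∈ R, r ∈ ringClassSubgroup K c jbar)
    (htrans : ∀ τ ∈ ringClassSubgroup K c jbar, ∃! r, r ∈ R ∧ r⁻¹ * τ ∈ ringClassSubgroup K c' jbar) :
    ∃ G : Finset (ringClassField K (jbar.comp (algebraMap K (AlgebraicClosure K))) c' ≃ₐ[ℚ]
        ringClassField K (jbar.comp (algebraMap K (AlgebraicClosure K))) c'),
      (∀ g, g ∈ G ↔ g ∈ ringClassGalOver (jbar.comp (algebraMap K (AlgebraicClosure K))) c' c) ∧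
      complexPoint W jbar (∑ r ∈ R, r • x) =
        WeierstrassCurve.Affine.Point.map (W' := W)
          (ringClassField K (jbar.comp (algebraMap K (AlgebraicClosure K))) c').subtype.toRatAlgHom
          (∑ g ∈ G, pointGalHom W _ g P) := by
  -- the restriction of every `r ∈ Γ_K` to `K[c']`, with an automorphism of `ℂ` inducing it
  choose σC hσC g hg hgσ using
    fun r : Field.absoluteGaloisGroup K ↦
      exists_ringEquiv_exists_mem_ringClassGal_of_absoluteGaloisGroup hK jbar hc' r
  -- pointwise: `(g_r • P)_ℂ = (r • x)_ℂ`
  have hpt : ∀ r, WeierstrassCurve.Affine.Point.map (W' := W)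
      (ringClassField K (jbar.comp (algebraMap K (AlgebraicClosure K))) c').subtype.toRatAlgHom (pointGalHom W _ (g r) P) =
      complexPoint W jbar (r • x) := fun r ↦ by
    rw [map_subtype_pointGalHom_eq_map W (jbar.comp (algebraMap K (AlgebraicClosure K))) (hgσ r) P, ← hxP, complexPoint_smul_eq_map W jbar (hσC r)]
  -- two elements with the same restriction lie in the same coset of `Gal(K̄/K[c'])`
  have hcoset : ∀ r₁ r₂ : Field.absoluteGaloisGroup K, g r₁ = g r₂ →
      r₂⁻¹ * r₁ ∈ ringClassSubgroup K c' jbar := by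
    intro r₁ r₂ h
    refine mem_ringClassSubgroup_of_ringEquiv_apply_eq_self (σC := (σC r₁).trans (σC r₂).symm) ?_ ?_
    · intro a
      rw [RingEquiv.trans_apply, RingEquiv.symm_apply_eq, hσC r₁, hσC r₂, mul_smul, smul_inv_smul]
    · intro u hu
      rw [RingEquiv.trans_apply, RingEquiv.symm_apply_eq]
      have e1 : ((g r₁ ⟨u, hu⟩ : ringClassField K (jbar.comp (algebraMap K (AlgebraicClosure K))) c') : ℂ) = σC r₁ u := hgσ r₁ ⟨u, hu⟩
      have e2 : ((g r₂ ⟨u, hu⟩ : ringClassField K (jbar.comp (algebraMap K (AlgebraicClosure K))) c') : ℂ) = σC r₂ u := hgσ r₂ ⟨u, hu⟩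
      rw [← e1, ← e2, h]
  have hinj : Set.InjOn g ↑R := by
    intro r₁ hr₁ r₂ hr₂ h
    have hu := htrans r₁ (hRsub r₁ hr₁)
    exact hu.unique ⟨hr₁, by rw [inv_mul_cancel]; exact Subgroup.one_mem _⟩ ⟨hr₂, hcoset r₁ r₂ h⟩
  refine ⟨R.image g, fun γ ↦ ⟨fun hγ ↦ ?_, fun hγ ↦ ?_⟩, ?_⟩
  · -- restrictions of elements of `Gal(K̄/K[c])` fix `K[c]`
    obtain ⟨r, hr, rfl⟩ := Finset.mem_image.mp hγ
    rw [ringClassGalOver, mem_fixingSubgroup_iff]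
    rintro y (hy : (y : ℂ) ∈ ringClassField K (jbar.comp (algebraMap K (AlgebraicClosure K))) c)
    apply Subtype.ext
    show ((g r y : ringClassField K (jbar.comp (algebraMap K (AlgebraicClosure K))) c') : ℂ) = y
    rw [hgσ r y]
    exact ringEquiv_apply_eq_self_of_mem_ringClassSubgroup hK hc (hRsub r hr) (hσC r) hy
  · -- every element of `Gal(K[c']/K[c])` lifts into `Gal(K̄/K[c])`, hence is the restriction of some `r ∈ R`
    obtain ⟨τ, hτ, τC, hτC, hτg⟩ :=
      exists_mem_ringClassSubgroup_induces_of_mem_ringClassGalOver hK jbar hcc' hc' hγ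
    obtain ⟨r, ⟨hr, hrτ⟩, -⟩ := htrans τ hτ
    refine Finset.mem_image.mpr ⟨r, hr, ?_⟩
    apply AlgEquiv.ext
    intro u
    apply Subtype.ext
    rw [hgσ r u, ← hτg u]
    obtain ⟨a, ha⟩ := mem_range_of_mem_ringClassField hK jbar hc' u.2
    rw [← ha, hσC r, hτC]
    congr 1
    have h1 : (r⁻¹ * τ) • a = a :=
      smul_eq_self_of_mem_ringClassSubgroup hK jbar hc' hrτ (by rw [ha]; exact u.2)
    calc r • a = r • ((r⁻¹ * τ) • a) := by rw [h1]
      _ = τ • a := by rw [← mul_smul, mul_inv_cancel_left]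
  · -- the sums
    rw [map_sum, map_sum, Finset.sum_image hinj]
    exact Finset.sum_congr rfl fun r _ ↦ (hpt r).symm

end Transversal

end Literature.NumberTheory.EllipticCurves

end
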